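import Summits.CriticalPhenomena.CardyFormulaZ2.Theorems.CardyIKTransportIKLinearTransportLine
import Literature.Probability.Percolation.Z2HalfPlaneTwoArm
import Literature.Probability.LatticeModels.SquareTilingCrosscut

/-!
# `CardyIKTransport.IKLinearTransport` (stmt-CriticalPhenomena-5076, line `pinned-diagram-exchange`, lead c8 wave 1) —
# theta-enclosure, part 1: winding numbers of CLOSED lattice walks

Support file (`--supports stmt-CriticalPhenomena-5076`) for the lattice Jordan lemma `thetaEnclosure` (a black
θ-curve of the cell triangulation through a wall encloses the white wall cells between its attachment runs).
This part is pure `ℤ²` combinatorics on top of the discrete winding number `walkWinding` of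
`Literature/Probability/Percolation/PlanarDuality.lean` (Kesten 1982, §2.2–2.3), reusing the tree's
`Z2HalfPlane.walkWinding_eq_zero_of_right` (a walk weakly left of `u` does not wind around `u`, `Z2HalfPlaneTwoArm`)
and `SquareTiling.walkWinding_eq_of_walk_closed` (constancy for closed walks, `SquareTilingCrosscut`):

* `theta_walkWinding_telescope` (registered) — if every vertex of a walk at the two critical heights `u₁, u₁ + 1`
  lies strictly to the right of `u`, the winding number telescopes to `[u₁ + 1 ≤ b₁] - [u₁ + 1 ≤ a₁]`
  (discrete intermediate value count; `-1` for a walk descending past the level on the right, `0` for a closed walk;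
  sharper than `Z2HalfPlane.walkWinding_eq_of_left`, which needs the WHOLE walk to the right of `u`);
* `ThetaEnclosureStub.walkWinding_closed_const` — for a CLOSED walk the winding number is the same around every vertex
  of a lattice walk avoiding it;
* `ThetaEnclosureStub.walkWinding_closed_box` — a closed walk inside a box winds only around points of the box;
* `ThetaEnclosureStub.exists_vertWalk` — straight vertical walks.
-/

noncomputable section

namespace Summit.CriticalPhenomena.CardyFormulaZ2.Theorems.IKLinearTransport.PinnedDiagramExchange

open Literature.Probability.Percolation Literature.Probability.LatticeModels
open SimpleGraph

namespace ThetaEnclosureStub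

/-- **Telescoping of the winding number.** If every vertex of the lattice walk `p : a ⟶ b` at height `u₁` or
`u₁ + 1` lies strictly to the right of `u`, then every vertical step of `p` between these two heights is counted, with
the sign of the change of the indicator `[u₁ + 1 ≤ ·₁]`, so the winding number telescopes. [folklore] -/
theorem walkWinding_telescope {a b : Site 2} (p : (zdGraph 2).Walk a b) (u : Site 2)
    (hp : ∀ z ∈ p.support, (z 1 = u 1 ∨ z 1 = u 1 + 1) → u 0 + 1 ≤ z 0) :
    walkWinding p u = (if u 1 + 1 ≤ b 1 then 1 else 0) - (if u 1 + 1 ≤ a 1 then 1 else 0) := by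
  induction p with
  | nil => simp
  | cons h p ih =>
    rename_i x y w
    rw [walkWinding_cons, ih fun v hv => hp v (by simp [hv])]
    have hx := hp x (by simp)
    have hy := hp y (by simp)
    by_cases hx1 : x 1 = u 1
    · have hx0 := hx (Or.inl hx1)
      rcases stepKind_of_adj h with ⟨h0, h1⟩ | ⟨h0, h1⟩ | ⟨h1, h0⟩ | ⟨h1, h0⟩
      · rw [stepWinding_right h0]; split_ifs <;> omega
      · rw [stepWinding_left h0]; split_ifs <;> omega
      · rw [stepWinding_up h1 h0]; split_ifs <;> omega
      · rw [stepWinding_down h1 h0]; split_ifs <;> omega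
    · by_cases hx2 : x 1 = u 1 + 1
      · have hx0 := hx (Or.inr hx2)
        rcases stepKind_of_adj h with ⟨h0, h1⟩ | ⟨h0, h1⟩ | ⟨h1, h0⟩ | ⟨h1, h0⟩
        · rw [stepWinding_right h0]; split_ifs <;> omega
        · rw [stepWinding_left h0]; split_ifs <;> omega
        · rw [stepWinding_up h1 h0]; split_ifs <;> omega
        · rw [stepWinding_down h1 h0]; split_ifs <;> omega
      · rcases stepKind_of_adj h with ⟨h0, h1⟩ | ⟨h0, h1⟩ | ⟨h1, h0⟩ | ⟨h1, h0⟩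
        · rw [stepWinding_right h0]; split_ifs <;> omega
        · rw [stepWinding_left h0]; split_ifs <;> omega
        · rw [stepWinding_up h1 h0]; split_ifs <;> omega
        · rw [stepWinding_down h1 h0]; split_ifs <;> omega

/-- **Constancy along avoiding walks, closed case.** The winding number of a CLOSED lattice walk `p` is the same
around every vertex of a lattice walk `q` that avoids the vertices of `p` (Kesten 1982, §2.2). [folklore] -/
theorem walkWinding_closed_const {a c d : Site 2} (p : (zdGraph 2).Walk a a) (q : (zdGraph 2).Walk c d)
    (hq : ∀ z ∈ q.support, z ∉ p.support) : ∀ w ∈ q.support, walkWinding p w = walkWinding p c := by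
  induction q with
  | nil =>
    intro w hw
    rw [Walk.support_nil, List.mem_singleton] at hw
    rw [hw]
  | cons h q ih =>
    rename_i x y w'
    intro w hw
    rw [Walk.support_cons, List.mem_cons] at hw
    rcases hw with rfl | hw
    · rfl
    · rw [ih (fun v hv => hq v (by simp [hv])) w hw]
      refine (SquareTiling.walkWinding_eq_of_walk_closed p (Walk.cons h Walk.nil) fun v hv => ?_).symm
      simp only [Walk.support_cons, Walk.support_nil, List.mem_cons, List.not_mem_nil, or_false] at hv
      rcases hv with rfl | rfl
      · exact hq _ (by simp)
      · exact hq _ (by simp)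

/-- A closed lattice walk inside the box `[x₁, x₂] × [y₁, y₂]` winds only around points `d` with
`x₁ ≤ d₀ < x₂` and `y₁ ≤ d₁ < y₂`. [folklore] -/
theorem walkWinding_closed_box {a : Site 2} (p : (zdGraph 2).Walk a a) {x₁ x₂ y₁ y₂ : ℤ}
    (hp : ∀ z ∈ p.support, x₁ ≤ z 0 ∧ z 0 ≤ x₂ ∧ y₁ ≤ z 1 ∧ z 1 ≤ y₂) {d : Site 2}
    (hd : walkWinding p d ≠ 0) : x₁ ≤ d 0 ∧ d 0 < x₂ ∧ y₁ ≤ d 1 ∧ d 1 < y₂ := by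
  by_contra hcon
  apply hd
  by_cases h1 : d 0 < x₁
  · rw [walkWinding_telescope p d (fun z hz _ => by have := hp z hz; omega)]; simp
  by_cases h2 : x₂ ≤ d 0
  · exact Z2HalfPlane.walkWinding_eq_zero_of_right (fun z hz => by have := hp z hz; omega)
  by_cases h3 : d 1 < y₁
  · exact walkWinding_eq_zero_of_ge (L := y₁) (fun z hz => (hp z hz).2.2.1) (by omega)
  by_cases h4 : y₂ ≤ d 1
  · exact walkWinding_eq_zero_of_le (N := y₂) (fun z hz => (hp z hz).2.2.2) h4
  exact absurd ⟨by omega, by omega, by omega, by omega⟩ hcon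

/-- Straight vertical lattice walks: from `x` up to the point `y` above it, through the column of `x` only. [folklore] -/
theorem exists_vertWalk (k : ℕ) : ∀ x y : Site 2, y 0 = x 0 → y 1 = x 1 + k →
    ∃ W : (zdGraph 2).Walk x y, ∀ z ∈ W.support, z 0 = x 0 ∧ x 1 ≤ z 1 ∧ z 1 ≤ y 1 := by
  induction k with
  | zero =>
    intro x y h0 h1
    have hxy : y = x := by
      rw [Site.eq_iff_two]; simp only [Nat.cast_zero, add_zero] at h1; exact ⟨h0, h1⟩
    subst hxy
    refine ⟨Walk.nil, fun z hz => ?_⟩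
    rw [Walk.support_nil, List.mem_singleton] at hz
    subst hz
    exact ⟨rfl, le_rfl, le_rfl⟩
  | succ k ih =>
    intro x y h0 h1
    obtain ⟨W, hW⟩ := ih (x + Pi.single 1 1) y (by simp [h0]) (by simp [h1]; ring)
    refine ⟨Walk.cons (adj_of_stepKind (.up (by simp) (by simp))) W, fun z hz => ?_⟩
    rw [Walk.support_cons, List.mem_cons] at hz
    rcases hz with rfl | hz
    · simp only [true_and, le_refl]
      simp only [h1]; push_cast; omega
    · have := hW z hz
      simp only [Pi.add_apply, single_one_apply_zero, add_zero, single_one_apply_one] at this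
      omega

end ThetaEnclosureStub

/-- **Telescoping of the lattice winding number** (registered support lemma of the theta-enclosure, stated in
arrow form). If every vertex of a `ℤ²`-walk `p : a ⟶ b` at height `u₁` or `u₁ + 1` lies strictly to the right of
`u`, then `walkWinding p u = [u₁ + 1 ≤ b₁] - [u₁ + 1 ≤ a₁]`: `-1` for a walk descending past the level of `u` on its
right, `0` for a closed walk. (Kesten 1982, §2.2, discrete intermediate value count.) [folklore] -/
theorem theta_walkWinding_telescope : ∀ (a b u : Site 2) (p : (zdGraph 2).Walk a b), (∀ z ∈ p.support, (z 1 = u 1 ∨ z 1 = u 1 + 1) → u 0 + 1 ≤ z 0) → walkWinding p u = (if u 1 + 1 ≤ b 1 then 1 else 0) - (if u 1 + 1 ≤ a 1 then 1 else 0) :=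
  fun _ _ u p hp => ThetaEnclosureStub.walkWinding_telescope p u hp

end Summit.CriticalPhenomena.CardyFormulaZ2.Theorems.IKLinearTransport.PinnedDiagramExchange

end
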